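import Literature.Probability.RandomPlanarGeometry.HexSAWRotSurfaceSqrtUpper
import HarnessLib

/-!
# Wall visits of ARMCHAIR wall bridges come in dimers: `visits n ω` is EVEN for every `ω ∈ Arm.wb n` (`n ≥ 1`),
# hence `B^w_n(y)` is an even polynomial in the fugacity: `B^w_n(−y) = B^w_n(y)`

Topic `Literature/Probability/RandomPlanarGeometry` (lane «pcv-sawmu», rotated-door lineage, a-p6 g14; a LANE LEMMA about Beaton's
rotated (armchair) surface, continuing `HexSAWArmchairWallBridges.lean` (`Arm.wb`, `Arm.visits`, `Arm.WB`) and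
`HexSAWRotSurfaceSqrtUpper.lean` (`Arm.no_three_walls`: no three consecutive wall vertices)).

THE FACT.  On the armchair boundary of the honeycomb half-plane (brick-wall frame: the wall is the column `X = 0`, whose vertical bonds
`(0,a)–(0,a+1)`, `a` even, are the surface dimers [Beaton2014RotatedHoneycomb, §2, Fig. 1]) a self-avoiding walk that ARRIVES at a wall
vertex from the bulk (horizontally, from `(1,a)`) can only continue along the surface dimer (the third neighbour `(−1,a)` is outside
the half-plane and `(1,a)` is used), and after the dimer it must leave the wall again (`no_three_walls`).  A wall bridge starts with the
dimer `(0,0)–(0,1)` (its level must rise at once) and ends with a dimer (its last step raises the level, so it is vertical, inside the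
wall).  Hence the wall visits of a wall bridge are partitioned into dimers:
* ★ `Arm.even_visits_of_mem_wb : 1 ≤ n → ω ∈ wb n → Even (visits n ω)`;
* ★ `Arm.WB_neg : WB n (−y) = WB n y` (and `WB_abs`) — the wall-bridge partition function is an even function of `y`;
* `Arm.four_le_visits_of_mem_wb` (`n ≥ 3 ⇒ visits ≥ 4`: the opening and closing dimers are disjoint), `Arm.visits_ne_of_odd`;
* the parity bookkeeping lemma `Arm.visits_mod_two_eq` (for every `m ≤ n`: `visits m ω` is odd iff time `m` is the FIRST vertex of a
  surface dimer), from which the above follow.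
Beaton counts surface VERTICES (`m` in `c_n^+(m)`, arXiv:1210.0274v3 §3.1 p. 11); for his unfolded walks / our wall bridges the count is
therefore always even — two per surface edge used.  HONEST LABEL: LANE LEMMA (XS–S), lattice combinatorics; not a printed statement (the
paper does not discuss the parity), recorded because the density-function module `HexSAWRotSurfaceDensityFunction.lean` (same lineage)
resolves wall bridges by their number of visits (`wbN m v`), whose support in `v` is thereby confined to the even numbers.
-/

noncomputable section

open Finset Function
open Literature.Probability.LatticeModels Literature.Probability.Percolation SimpleGraph

namespace Literature.Probability.RandomPlanarGeometry.SAW.HexBW.Arm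

variable {y : ℝ} {n : ℕ} {ω : ℕ → Site 2}

/-- A wall bridge of length `n ≥ 2` ENDS with a surface dimer: `ω (n−1)` is on the wall (the last step raises the level, so it is the
vertical bond inside the column `X = 0`). [cite: Beaton2014RotatedHoneycomb, §2 (Fig. 1: the armchair surface) and §3.1 (arXiv v3 p. 12: unfolded walks)] -/
theorem wall_pred_of_mem_wb (hn : 2 ≤ n) (hω : ω ∈ wb n) : ω (n - 1) 0 = 0 := by
  obtain ⟨hs, -, hend, -, hint⟩ := wb_anatomy hω
  obtain ⟨-, -, hbw, -⟩ := mem_saws_iff.1 hs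
  have hlt := (hint (n - 1) (by omega) (by omega)).2
  have s := step_cases (hbw (n - 1) (by omega))
  rw [show n - 1 + 1 = n by omega] at s
  omega

/-- A wall bridge of length `n ≥ 1` STARTS with the surface dimer `(0,0)–(0,1)`: `ω 1` is on the wall.
[cite: Beaton2014RotatedHoneycomb, §2 (Fig. 1) and §3.1 (arXiv v3 p. 12: unfolded walks)] -/
theorem wall_one_of_mem_wb (hn : 1 ≤ n) (hω : ω ∈ wb n) : ω 1 0 = 0 := by
  obtain ⟨hs, -, hend, hpos, hint⟩ := wb_anatomy hω
  obtain ⟨h0, -, hbw, -⟩ := mem_saws_iff.1 hs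
  rcases Nat.lt_or_ge 1 n with h1 | h1
  · have hlt := (hint 1 le_rfl h1).1
    have s := step_cases (hbw 0 (by omega))
    rw [zero_add, h0] at s
    have e0 : (0 : Site 2) 0 = 0 := rfl
    have e1 : (0 : Site 2) 1 = 0 := rfl
    rw [e0, e1] at s
    omega
  · have : n = 1 := by omega
    subst this; exact hend

/-- **A run of wall vertices that starts at time `m` continues at time `m + 1`**: if `ω m` is on the wall and either `m = 0` or
`ω (m−1)` is off the wall, then `ω (m+1)` is on the wall (`m + 1 ≤ n`).  Arriving horizontally from `(1,a)`, the walk cannot step back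
and cannot leave the half-plane, so it takes the surface dimer. [cite: Beaton2014RotatedHoneycomb, §2 (Fig. 1: the armchair surface)] [cite: EntingJensen2009, §7.4.2, Fig. 7.10 (brickwork form)] -/
theorem wall_succ_of_runStart (hn : 1 ≤ n) (hω : ω ∈ wb n) {m : ℕ} (hm : m + 1 ≤ n) (hW : ω m 0 = 0)
    (hstart : m = 0 ∨ ω (m - 1) 0 ≠ 0) : ω (m + 1) 0 = 0 := by
  rcases hstart with rfl | hprev
  · exact wall_one_of_mem_wb hn hω
  · have hm1 : 1 ≤ m := by
      rcases Nat.eq_zero_or_pos m with rfl | h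
      · exact absurd hW (by simpa using hprev)
      · exact h
    obtain ⟨hs, hH, -, -, -⟩ := wb_anatomy hω
    obtain ⟨-, -, hbw, hinj⟩ := mem_saws_iff.1 hs
    have s1 := step_cases (hbw (m - 1) (by omega))
    have s2 := step_cases (hbw m (by omega))
    rw [show m - 1 + 1 = m by omega] at s1
    have hX0 := hH (m - 1) (by omega)
    have hX2 := hH (m + 1) (by omega)
    have hne : ω (m - 1) ≠ ω (m + 1) := fun e => by
      have := hinj (show m - 1 ∈ {j | j ≤ n} by simp; omega) (show m + 1 ∈ {j | j ≤ n} by simp; omega) e; omega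
    rw [Ne, site_two_eq_iff] at hne
    omega

/-- **Parity bookkeeping**: for `m ≤ n`, `visits m ω` is ODD exactly when time `m` is the first vertex of a surface dimer
(`ω m` on the wall and `m = 0` or `ω (m−1)` off the wall). [cite: Beaton2014RotatedHoneycomb, §2 (Fig. 1) and §3.1 (arXiv v3 p. 11: "occupying m vertices in the surface")] -/
theorem visits_mod_two_eq (hn : 1 ≤ n) (hω : ω ∈ wb n) :
    ∀ m ≤ n, visits m ω % 2 = if ω m 0 = 0 ∧ (m = 0 ∨ ω (m - 1) 0 ≠ 0) then 1 else 0 := by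
  have hhp : ω ∈ hp n := arches_subset (wb_subset hω)
  obtain ⟨hs, -, -, -, -⟩ := wb_anatomy hω
  have h0 : ω 0 = 0 := (mem_saws_iff.1 hs).1
  have hw0 : ω 0 0 = 0 := by rw [h0]; rfl
  intro m
  induction m with
  | zero => intro _; simp [visits_zero, hw0]
  | succ m ih =>
      intro hm
      have ih' := ih (by omega)
      have e : visits (m + 1) ω = visits m ω + (if ω (m + 1) 0 = 0 then 1 else 0) := visits_succ m ω
      rw [show m + 1 - 1 = m by omega]
      by_cases hW1 : ω (m + 1) 0 = 0
      · rw [if_pos hW1] at e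
        by_cases hW : ω m 0 = 0
        · -- two consecutive wall vertices: `m` starts the dimer (no three walls), so `visits m` is odd
          have hfirst : ω m 0 = 0 ∧ (m = 0 ∨ ω (m - 1) 0 ≠ 0) := by
            refine ⟨hW, ?_⟩
            rcases Nat.eq_zero_or_pos m with rfl | hm0
            · exact Or.inl rfl
            · right; intro hprev
              exact no_three_walls hhp (i := m - 1) (by omega)
                ⟨hprev, by rw [show m - 1 + 1 = m by omega]; exact hW, by rw [show m - 1 + 2 = m + 1 by omega]; exact hW1⟩
          rw [if_pos hfirst] at ih'
          have : ¬ (ω (m + 1) 0 = 0 ∧ (m + 1 = 0 ∨ ω m 0 ≠ 0)) := fun h => by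
            rcases h.2 with h' | h'
            · omega
            · exact h' hW
          rw [if_neg this]; omega
        · have hnf : ¬ (ω m 0 = 0 ∧ (m = 0 ∨ ω (m - 1) 0 ≠ 0)) := fun h => hW h.1
          rw [if_neg hnf] at ih'
          rw [if_pos ⟨hW1, Or.inr hW⟩]; omega
      · rw [if_neg hW1] at e
        have hnf1 : ¬ (ω (m + 1) 0 = 0 ∧ (m + 1 = 0 ∨ ω m 0 ≠ 0)) := fun h => hW1 h.1
        rw [if_neg hnf1]
        -- `visits m` is even: time `m` cannot start a dimer (it would continue at `m + 1`)
        have hnf : ¬ (ω m 0 = 0 ∧ (m = 0 ∨ ω (m - 1) 0 ≠ 0)) := fun h =>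
          hW1 (wall_succ_of_runStart hn hω (by omega) h.1 h.2)
        rw [if_neg hnf] at ih'
        omega

/-- ★ **The number of wall visits of an armchair wall bridge is EVEN** (`n ≥ 1`): the visits are partitioned into surface dimers.
[cite: Beaton2014RotatedHoneycomb, §2 (Fig. 1: the armchair surface) and §3.1 (arXiv v3 pp. 11–12: surface vertices of unfolded walks)] -/
theorem even_visits_of_mem_wb (hn : 1 ≤ n) (hω : ω ∈ wb n) : Even (visits n ω) := by
  have h := visits_mod_two_eq hn hω n le_rfl
  have hlast : ¬ (ω n 0 = 0 ∧ (n = 0 ∨ ω (n - 1) 0 ≠ 0)) := by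
    rintro ⟨-, h' | h'⟩
    · omega
    · rcases Nat.lt_or_ge n 2 with h2 | h2
      · have : n = 1 := by omega
        subst this
        obtain ⟨hs, -, -, -, -⟩ := wb_anatomy hω
        have h0 : ω 0 = 0 := (mem_saws_iff.1 hs).1
        exact h' (by rw [show 1 - 1 = 0 from rfl, h0]; rfl)
      · exact h' (wall_pred_of_mem_wb h2 hω)
  rw [if_neg hlast] at h
  exact Nat.even_iff.2 h

/-- **At least four wall visits** for a wall bridge of length `n ≥ 3`: the opening dimer (times `0, 1`) and the closing dimer
(times `n − 1, n`) are disjoint. [cite: Beaton2014RotatedHoneycomb, §2 (Fig. 1) and §3.1 (arXiv v3 pp. 11–12)] -/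
theorem four_le_visits_of_mem_wb (hn : 3 ≤ n) (hω : ω ∈ wb n) : 4 ≤ visits n ω := by
  obtain ⟨hs, -, hend, -, -⟩ := wb_anatomy hω
  have h0 : ω 0 = 0 := (mem_saws_iff.1 hs).1
  have hw0 : ω 0 0 = 0 := by rw [h0]; rfl
  have hw1 : ω 1 0 = 0 := wall_one_of_mem_wb (by omega) hω
  have hwp : ω (n - 1) 0 = 0 := wall_pred_of_mem_wb (by omega) hω
  have v0 : visits 0 ω = if ω 0 0 = 0 then 1 else 0 := visits_zero ω
  have e1 : visits 1 ω = visits 0 ω + (if ω 1 0 = 0 then 1 else 0) := visits_succ 0 ω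
  have e2 := visits_succ (n - 2) ω
  rw [show n - 2 + 1 = n - 1 by omega] at e2
  have e3 := visits_succ (n - 1) ω
  rw [show n - 1 + 1 = n by omega] at e3
  have hmono : visits 1 ω ≤ visits (n - 2) ω := visits_mono (by omega) ω
  rw [if_pos hw0] at v0; rw [if_pos hw1] at e1; rw [if_pos hwp] at e2; rw [if_pos hend] at e3
  omega

/-- The visit count of a wall bridge is never odd (restated as `≠` for direct use with `wbN`-type counts).
[cite: Beaton2014RotatedHoneycomb, §3.1 (arXiv v3 p. 11: "occupying m vertices in the surface")] -/
theorem visits_ne_of_odd (hn : 1 ≤ n) (hω : ω ∈ wb n) {v : ℕ} (hv : ¬ Even v) : visits n ω ≠ v :=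
  fun h => hv (h ▸ even_visits_of_mem_wb hn hω)

/-- The weight `y^{visits}` of a wall bridge is unchanged under `y ↦ −y`. [cite: Beaton2014RotatedHoneycomb, §3.1 (arXiv v3 p. 11: the surface weight y^m)] -/
theorem neg_pow_visits_of_mem_wb (hn : 1 ≤ n) (hω : ω ∈ wb n) (y : ℝ) : (-y) ^ visits n ω = y ^ visits n ω :=
  (even_visits_of_mem_wb hn hω).neg_pow y

/-- ★ **`B^w_n(−y) = B^w_n(y)`**: the armchair wall-bridge partition function is an EVEN function of the surface fugacity (`n ≥ 1`).
[cite: Beaton2014RotatedHoneycomb, §3.1 (arXiv v3 pp. 11–12: B-type generating functions of unfolded walks with weight y^m)] -/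
theorem WB_neg (hn : 1 ≤ n) (y : ℝ) : WB n (-y) = WB n y := by
  rw [WB, WB]
  exact Finset.sum_congr rfl fun ω hω => neg_pow_visits_of_mem_wb hn hω y

/-- `B^w_n(y) = B^w_n(|y|)` (`n ≥ 1`). [cite: Beaton2014RotatedHoneycomb, §3.1 (arXiv v3 pp. 11–12)] -/
theorem WB_abs (hn : 1 ≤ n) (y : ℝ) : WB n |y| = WB n y := by
  rcases le_or_gt 0 y with hy | hy
  · rw [abs_of_nonneg hy]
  · rw [abs_of_neg hy, WB_neg hn]

end Literature.Probability.RandomPlanarGeometry.SAW.HexBW.Arm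

end
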